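import Summits.QuantumFields.YangMills.Theorems.BalabanUVNodesN15CovariantAveragingLetterLocal
import Summits.QuantumFields.YangMills.Theorems.BalabanUVNodesN15PerCubeGreenLandauLetterKnitRow
import HarnessLib

/-!
# N15 = NE2, road (c) — PROGRAMME (PC), (PC-F) «the per-cube KNIT», III: THE ROWS OF THE AVERAGING PERTURBATION `N_V^Q(U^{w_k})` BEHIND THE INPUT CUT `χ_k` FROM THE PER-CUBE (3.35)
# DATUM, in the knit's bond-point convention (dag-n15-c g30, n15-c∕318)

Cell `pub-ymgap`, seat `pub-ymgap-dag-n15-c` (generation g30; R134 (a), s1; HUMAN RULING D-0062).  `bears_on: R4∕N15 · K3⁸ SpineGivenEndpointR13SepCoPHV (stmt-QuantumFields-27366)`;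
filed `--kind proof --supports stmt-QuantumFields-27366 --as helper` — COUNT-NEUTRAL.  Theorems only, 0 `def`, 0 `sorry`; bookkeeping over landed theorems, no estimate of Bałaban's.
Imports BY NAME n15-c∕317 `…CovariantAveragingLetterLocal` (★★★ `cv_hasMaj_sandwich_cvNVq_local`), n15-c∕315 `…PerCubeGreenLandauLetterKnitRow` (`cvGauge_comp_fst_eq_gaugeTr`; through it
n15-c∕`rows_cols_cvT_sub_one_le_of_datum` (dag-n15-w2's (3.35) operator∕entry letters), FILE 117's nested boxes `mem_cubeBlocks_of_mem_inner`, n15-c∕127 `add_unitVec_mem_cubeBlocks_of_mem` ∕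
`sub_unitVec_mem_cubeBlocks_of_mem`, `coverMargin_fit`, dag-n15-a `chiCube_of_not_mem` ∕ `abs_chiCube_le_one`, r07 `gaugeTr_one`).  Nothing in the tree is modified.

WHY ((PC-F), HOME HANDOFF §g29 RECIPE (3)–(4)).  The knit n15-c∕202∕203 (and their capped twins n15-c∕316) display the near∕far rows of `N_V k = (N_V^Q + N_V^R)(U^{u₀ k})` behind the
input cut `χ_k`.  n15-c∕315 supplies the `R`-part from the per-cube (3.35) datum of n15-c∕313∕314 (cube gauges `w_k`, potentials on the locality box `c(Lw+6w−m₀,k)+[0,Lw+16w+2)`).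
THIS FILE supplies the `Q`-part from the SAME datum: the one-step neighbourhood `S′ = c(2w+1,k)+[0,6w+3)` of the cut box `S = c(2w,k)+[0,6w+1)` lies in the locality box (§1), the
transporter letters of `U^{w_k}` hold there by dag-n15-w2's letters read through n15-c∕`rows_cols_cvT_sub_one_le_of_datum` (the gauged field IS `e^{iηA_k}` on the box: trivial gauge),
and n15-c∕317 turns box-local letters into the row.  Any left cut `|f| ≤ 1` (`ψ_k`, `1 − ψ_k`), any rate `δ > 0`, any mass letter `a`.

WHAT.  §1 geometry: `cvChi_blockOf_mem` (`B(supp χ_k) ⊆ S`), `cutBox_step_mem_nbhdBox` (`S ∪ (S ± e_κ) ⊆ S′` stepwise), `nbhdBox_subset_localityBox` (`S′ ⊆` the locality box;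
`L ≥ 17`, `w ≥ 2`).  §2 ★★★ `hasMaj_sandwich_cvNVq_cvGauge_cut`: under n15-c∕315's datum, for every cube `k`, every `|f| ≤ 1`, every `δ > 0`:
`M_f ∘ N_V^Q((U∘fst)^{w_k∘fst}) ∘ M_{χ_k} ≤ |a|K(2+K)·c_δe^{3δ}·e^{−δd}` in `CvNorm`, `K = (1+ρ)^{(d+2)L^k} − 1`, `ρ = |ι|κ_e·2√m·√m·η(C∕ξ)e^{ηC∕ξ}`, `η = L^{−k}` — the shape of
203's `hNVcut`∕`hfarN` for the `Q`-part of `N_V k`.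

HONEST FRAMING ∕ LIMITS.  Assembly of LANDED theorems on MODEL carriers (doubled-torus cover; `Q(U)` = main term (125) of [B7] (124); the gauges `w_k` and potentials are a DATUM per cube —
the print's ∃ in (3.35) is the caller's); [B9] (3.26) p.395, (3.35) p.396, (3.59)–(3.60) p.402, Cor. 3.8 p.410 cited for SHAPES ∕ MECHANISM only.  NE2⁺ NOT PRINTED, NOT proved; N15 of record
untouched (DISCHARGED AS CONSUMED, p687738); K3⁸ OPEN; counts UNMOVED (typed 28∕28); one finite 𝕋⁴ at fixed ε per index — NOT infinite volume, NOT OS on ℝ⁴, NOT a mass gap, NOT Clay.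
Restate-immune (no Theses import).
-/

noncomputable section

open scoped BigOperators Matrix Matrix.Norms.L2Operator

namespace Summit.QuantumFields.YangMills.BalabanUVNodes.N15.Gluing

open Real
open Literature.MathematicalPhysics.QuantumFieldTheory.Balaban1983to89
open Literature.MathematicalPhysics.QuantumFieldTheory.Balaban1983to89.B5Prop11Plancherel (Tor fine unitVec)
open Literature.MathematicalPhysics.QuantumFieldTheory.Balaban1983to89.B11SectG (BlockNorm HasMaj)
open Literature.MathematicalPhysics.QuantumFieldTheory.Balaban1983to89.B6Prop26Gluing (mulOp mulOp_apply)
open Literature.MathematicalPhysics.QuantumFieldTheory.Balaban1983to89.B6UnitTorusCarrier (unitTorusGeo)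
open Literature.MathematicalPhysics.QuantumFieldTheory.Balaban1983to89.B9Eq3117Current (gaugeTr gaugeTr_one)
open Literature.MathematicalPhysics.QuantumFieldTheory.Balaban1983to89.B9Eq39Adjoint (covD fluct)
open Literature.MathematicalPhysics.QuantumFieldTheory.King1986.Torus (blockOf)
open Summit.QuantumFields.YangMills.BalabanUVNodes.N15.MatrixSpecies (coordMat basisConst)
open Summit.QuantumFields.YangMills.BalabanUVNodes.N15.TwoGrid (cubeBlocks chiCube chiCube_of_not_mem abs_chiCube_le_one)
open Summit.QuantumFields.YangMills.BalabanUVNodes.N15.CurvedSpecies (uN_val_gaugeTr_eq)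

variable {d : ℕ}

/-! ## §1 Geometry: the cut box, its one-step neighbourhood, the locality box -/

section Geometry

variable {L : ℕ} [NeZero L]

/-- `B(supp χ_k) ⊆ S = c(2w,k)+[0,6w+1)`: the input cut is the indicator of the blocks of its box. [cite: Balaban1985BackgroundPropagators, (3.62)–(3.65) pp.402–403 (shape)] -/
theorem cvChi_blockOf_mem (hL : Odd L ∧ 1 < L) (mv kk : ℕ) (k : Fin (d + 1) → ZMod (2 * L)) (p : CvX d L mv kk hL) (hp : cvChi d L mv kk hL k p ≠ 0) :
    blockOf (L ^ kk) (cvM d L mv kk hL) p.1 ∈ cubeBlocks (cvM d L mv kk hL) (coverCorner (cvM d L mv kk hL) (L ^ mv) L (2 * L ^ mv) k) (6 * L ^ mv + 1) := by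
  by_contra h
  exact hp (chiCube_of_not_mem h)

omit [NeZero L] in
/-- `S ∪ (S ± e_κ) ⊆ S′ = c(2w+1,k)+[0,6w+3)` stepwise: `y ∈ S ∨ y + e_κ ∈ S ⟹ y ∈ S′ ∧ y + e_κ ∈ S′` (`L ≥ 7`). [cite: Balaban1985BackgroundPropagators, (3.62)–(3.65) pp.402–403 (nested boxes: shape)] -/
theorem cutBox_step_mem_nbhdBox (hL : Odd L ∧ 1 < L) (hL7 : 7 ≤ L) (mv kk : ℕ) (k : Fin (d + 1) → ZMod (2 * L)) (y : Tor (cvM d L mv kk hL)) (κ : Fin (d + 1))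
    (hy : y ∈ cubeBlocks (cvM d L mv kk hL) (coverCorner (cvM d L mv kk hL) (L ^ mv) L (2 * L ^ mv) k) (6 * L ^ mv + 1) ∨
      y + unitVec (cvM d L mv kk hL) κ ∈ cubeBlocks (cvM d L mv kk hL) (coverCorner (cvM d L mv kk hL) (L ^ mv) L (2 * L ^ mv) k) (6 * L ^ mv + 1)) :
    y ∈ cubeBlocks (cvM d L mv kk hL) (coverCorner (cvM d L mv kk hL) (L ^ mv) L (2 * L ^ mv + 1) k) (6 * L ^ mv + 3) ∧
      y + unitVec (cvM d L mv kk hL) κ ∈ cubeBlocks (cvM d L mv kk hL) (coverCorner (cvM d L mv kk hL) (L ^ mv) L (2 * L ^ mv + 1) k) (6 * L ^ mv + 3) := by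
  have hM : ∀ ν, cvM d L mv kk hL ν = 2 * L * L ^ mv := MP_succ_eq L mv kk hL
  have hS : 6 * L ^ mv + 3 ≤ 2 * L * L ^ mv := by
    have h7 : 7 * L ^ mv ≤ L * L ^ mv := Nat.mul_le_mul_right _ hL7
    have hw : 1 ≤ L ^ mv := Nat.one_le_pow _ _ (by omega)
    have e : 2 * L * L ^ mv = 2 * (L * L ^ mv) := by ring
    rw [e]; omega
  rcases hy with hy | hy
  · exact ⟨mem_cubeBlocks_of_mem_inner hM (by omega) (by omega) hS hy, add_unitVec_mem_cubeBlocks_of_mem hM (by omega) (by omega) hS hy κ⟩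
  · refine ⟨?_, mem_cubeBlocks_of_mem_inner hM (by omega) (by omega) hS hy⟩
    have h := sub_unitVec_mem_cubeBlocks_of_mem hM (m₀ := 2 * L ^ mv + 1) (S₀ := 6 * L ^ mv + 3) (by omega) (by omega) hS hy κ
    rwa [add_sub_cancel_right] at h

omit [NeZero L] in
/-- `S′ = c(2w+1,k)+[0,6w+3)` lies in the locality box `c(Lw+6w−m₀,k)+[0,Lw+16w+2)` of n15-c∕313∕314∕315 (`L ≥ 17`, `w = L^m ≥ 2`, `m₀ = coverMargin`).
[cite: Balaban1985BackgroundPropagators, (3.62)–(3.65) pp.402–403 (nested boxes: shape)] -/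
theorem nbhdBox_subset_localityBox (hL : Odd L ∧ 1 < L) (hL17 : 17 ≤ L) (mv kk : ℕ) (hW2 : 2 ≤ L ^ mv) (k : Fin (d + 1) → ZMod (2 * L)) {y : Tor (cvM d L mv kk hL)}
    (hy : y ∈ cubeBlocks (cvM d L mv kk hL) (coverCorner (cvM d L mv kk hL) (L ^ mv) L (2 * L ^ mv + 1) k) (6 * L ^ mv + 3)) :
    y ∈ cubeBlocks (cvM d L mv kk hL) (coverCorner (cvM d L mv kk hL) (L ^ mv) L (L * L ^ mv + 6 * L ^ mv - coverMargin L mv) k) (L * L ^ mv + 16 * L ^ mv + 2) := by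
  have hM : ∀ ν, cvM d L mv kk hL ν = 2 * L * L ^ mv := MP_succ_eq L mv kk hL
  have hcm := coverMargin_fit (show 3 ≤ L by omega) mv
  have h17 : 17 * L ^ mv ≤ L * L ^ mv := Nat.mul_le_mul_right _ hL17
  have e : 2 * L * L ^ mv = 2 * (L * L ^ mv) := by ring
  have hS : L * L ^ mv + 16 * L ^ mv + 2 ≤ 2 * L * L ^ mv := by rw [e]; omega
  exact mem_cubeBlocks_of_mem_inner hM (by omega) (by omega) hS hy

end Geometry

/-! ## §2 The rows of `N_V^Q(U^{w_k})` behind the input cut -/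

section Knit

variable {L : ℕ} [NeZero L]

/-- ★★★ **THE `hNVcut`∕`hfarN` ROWS OF THE AVERAGING PART `N_V^Q` PER CUBE, IN THE KNIT's CONVENTION, FROM THE PER-CUBE (3.35) DATUM.**  `L ≥ 17` odd, `w = L^m ≥ 2`; unitary site
field `U`; (3.35) letters `ξ > 0`, `C ≥ 0`; unitary cube gauges `w_k` with potentials `A_k`, `U^{w_k} = e^{iηA_k}`, `‖A_k‖ < C∕ξ`, `‖η⁻¹∇^ηA_k‖ < C∕ξ²` on `c(Lw+6w−m₀,k)+[0,Lw+16w+2)`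
(n15-c∕315's datum VERBATIM); then for every cube `k`, left cut `|f| ≤ 1`, rate `δ > 0`, mass letter `a`:
`M_f ∘ N_V^Q((U∘fst)^{w_k∘fst}) ∘ M_{χ_k} ≤ |a|K(2+K)·c_δe^{3δ}·e^{−δ|y−y′|_T}`, `K = (1+ρ)^{(d+2)L^k} − 1`, `ρ = |ι|κ_e·2√m·√m·η(C∕ξ)e^{ηC∕ξ}` (MODEL carriers).
[cite: Balaban1985BackgroundPropagators, (3.26) p.395, (3.35) p.396, (3.59)–(3.60) p.402, Cor. 3.8 p.410 (shapes ∕ mechanism); Balaban1985Averaging, (125)–(126) p.36] -/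
theorem hasMaj_sandwich_cvNVq_cvGauge_cut (hL : Odd L ∧ 1 < L) (hL17 : 17 ≤ L) (mv kk : ℕ) (hW2 : 2 ≤ L ^ mv)
    {mm : Type} [Fintype mm] [DecidableEq mm] [Nonempty mm] (ι : Type) [Fintype ι] [DecidableEq ι] (e : Matrix mm mm ℂ ≃L[ℝ] (ι → ℝ))
    (U : Fin (d + 1) → ScX d L mv kk hL → (Matrix mm mm ℂ)ˣ) (hU : ∀ μ x, (U μ x : Matrix mm mm ℂ) ∈ Matrix.unitaryGroup mm ℂ)
    {ξ C : ℝ} (hξ : 0 < ξ) (hC : 0 ≤ C)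
    (w : (Fin (d + 1) → ZMod (2 * L)) → ScX d L mv kk hL → (Matrix mm mm ℂ)ˣ) (hwU : ∀ k x, (w k x : Matrix mm mm ℂ) ∈ Matrix.unitaryGroup mm ℂ)
    (hdat : ∀ k : Fin (d + 1) → ZMod (2 * L), ∃ A : Fin (d + 1) → ScX d L mv kk hL → Matrix mm mm ℂ,
          (∀ μ, ∀ z ∈ {x : ScX d L mv kk hL | blockOf (L ^ kk) (cvM d L mv kk hL) x ∈ cubeBlocks (cvM d L mv kk hL) (coverCorner (cvM d L mv kk hL) (L ^ mv) L (L * L ^ mv + 6 * L ^ mv - coverMargin L mv) k) (L * L ^ mv + 16 * L ^ mv + 2)}, gaugeTr (scShift d L mv kk hL) (w k) U μ z = fluct (((((L ^ kk : ℕ) : ℝ))⁻¹)) A μ z) ∧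
          (∀ μ, ∀ z ∈ {x : ScX d L mv kk hL | blockOf (L ^ kk) (cvM d L mv kk hL) x ∈ cubeBlocks (cvM d L mv kk hL) (coverCorner (cvM d L mv kk hL) (L ^ mv) L (L * L ^ mv + 6 * L ^ mv - coverMargin L mv) k) (L * L ^ mv + 16 * L ^ mv + 2)}, ‖A μ z‖ < C * ξ⁻¹) ∧
          (∀ μ ν, ∀ z ∈ {x : ScX d L mv kk hL | blockOf (L ^ kk) (cvM d L mv kk hL) x ∈ cubeBlocks (cvM d L mv kk hL) (coverCorner (cvM d L mv kk hL) (L ^ mv) L (L * L ^ mv + 6 * L ^ mv - coverMargin L mv) k) (L * L ^ mv + 16 * L ^ mv + 2)}, ‖((↑(((((L ^ kk : ℕ) : ℝ))⁻¹)) : ℂ)⁻¹) • covD (scShift d L mv kk hL) (fun _ _ => (1 : (Matrix mm mm ℂ)ˣ)) μ (A ν) z‖ < C * (ξ ^ 2)⁻¹))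
    (a : ℝ) {δ : ℝ} (hδ : 0 < δ) (k : Fin (d + 1) → ZMod (2 * L)) (f : CvX d L mv kk hL → ℝ) (hf : ∀ x, |f x| ≤ 1) :
    HasMaj (CvNorm d L mv kk hL ι) (CvNorm d L mv kk hL ι)
      (mulOp (fun p : CvX d L mv kk hL × ι => f p.1) ∘ₗ
        cvNVq d L mv kk hL a ι e (cvGauge d L mv kk hL (fun p : CvX d L mv kk hL => (w k p.1 : Matrix mm mm ℂ)) (fun μ (p : CvX d L mv kk hL) => (U μ p.1 : Matrix mm mm ℂ))) ∘ₗ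
        mulOp (fun q : CvX d L mv kk hL × ι => cvChi d L mv kk hL k q.1))
      (fun y y' => |a| * (((1 + Fintype.card ι * (@basisConst ι _ (Matrix mm mm ℂ) Matrix.frobeniusNormedAddCommGroup Matrix.frobeniusNormedSpace e * (2 * Real.sqrt (Fintype.card mm)) * (Real.sqrt (Fintype.card mm) * (((((L ^ kk : ℕ) : ℝ))⁻¹) * (C / ξ) * Real.exp (((((L ^ kk : ℕ) : ℝ))⁻¹) * (C / ξ)))))) ^ ((d + 2) * L ^ kk) - 1) * (2 + ((1 + Fintype.card ι * (@basisConst ι _ (Matrix mm mm ℂ) Matrix.frobeniusNormedAddCommGroup Matrix.frobeniusNormedSpace e * (2 * Real.sqrt (Fintype.card mm)) * (Real.sqrt (Fintype.card mm) * (((((L ^ kk : ℕ) : ℝ))⁻¹) * (C / ξ) * Real.exp (((((L ^ kk : ℕ) : ℝ))⁻¹) * (C / ξ)))))) ^ ((d + 2) * L ^ kk) - 1)) * (B4Sect5Proof.latticeConst (d + 1) δ * Real.exp (3 * δ))) *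
        Real.exp (-(δ * (unitTorusGeo L kk (cvM d L mv kk hL)).dist y y'))) := by
  classical
  have hL7 : 7 ≤ L := by omega
  have hnr : (0 : ℝ) < ((L ^ kk : ℕ) : ℝ) := by exact_mod_cast Nat.pos_of_ne_zero (NeZero.ne _)
  have hη : (0 : ℝ) < ((((L ^ kk : ℕ) : ℝ))⁻¹) := inv_pos.mpr hnr
  have hρ : (0 : ℝ) ≤ Fintype.card ι * (@basisConst ι _ (Matrix mm mm ℂ) Matrix.frobeniusNormedAddCommGroup Matrix.frobeniusNormedSpace e * (2 * Real.sqrt (Fintype.card mm)) * (Real.sqrt (Fintype.card mm) * (((((L ^ kk : ℕ) : ℝ))⁻¹) * (C / ξ) * Real.exp (((((L ^ kk : ℕ) : ℝ))⁻¹) * (C / ξ))))) := by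
    have := @MatrixSpecies.basisConst_nonneg ι _ (Matrix mm mm ℂ) Matrix.frobeniusNormedAddCommGroup Matrix.frobeniusNormedSpace e
    have hCξ : 0 ≤ C / ξ := div_nonneg hC hξ.le
    positivity
  -- the gauged field of cube `k` and its (3.35) datum in the trivial gauge on the locality box
  obtain ⟨A, hg, hA, hD⟩ := hdat k
  have hu : ∀ x, (w k x : Matrix mm mm ℂ) ∈ Matrix.unitaryGroup mm ℂ := hwU k
  have hVu : ∀ μ x, (gaugeTr (scShift d L mv kk hL) (w k) U μ x : Matrix mm mm ℂ) ∈ Matrix.unitaryGroup mm ℂ := fun μ x => by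
    rw [uN_val_gaugeTr_eq (T := scShift d L mv kk hL) U (hu (scShift d L mv kk hL μ x))]
    exact Submonoid.mul_mem _ (Submonoid.mul_mem _ (hu x) (hU μ x)) (Unitary.star_mem (hu (scShift d L mv kk hL μ x)))
  have hg1 : ∀ μ, ∀ z ∈ {x : ScX d L mv kk hL | blockOf (L ^ kk) (cvM d L mv kk hL) x ∈ cubeBlocks (cvM d L mv kk hL) (coverCorner (cvM d L mv kk hL) (L ^ mv) L (L * L ^ mv + 6 * L ^ mv - coverMargin L mv) k) (L * L ^ mv + 16 * L ^ mv + 2)},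
      gaugeTr (scShift d L mv kk hL) (fun _ => (1 : (Matrix mm mm ℂ)ˣ)) (gaugeTr (scShift d L mv kk hL) (w k) U) μ z = fluct (((((L ^ kk : ℕ) : ℝ))⁻¹)) A μ z := fun μ z hz => by
    rw [gaugeTr_one]; exact hg μ z hz
  -- the dictionary: the knit's gauged bond-point field is the gauged site field read at the bond's base point
  rw [cvGauge_comp_fst_eq_gaugeTr (hwU k) U]
  refine cv_hasMaj_sandwich_cvNVq_local e mv kk hL a hρ hδ
    (S := cubeBlocks (cvM d L mv kk hL) (coverCorner (cvM d L mv kk hL) (L ^ mv) L (2 * L ^ mv) k) (6 * L ^ mv + 1))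
    (S' := cubeBlocks (cvM d L mv kk hL) (coverCorner (cvM d L mv kk hL) (L ^ mv) L (2 * L ^ mv + 1) k) (6 * L ^ mv + 3))
    (fun y κ hy => cutBox_step_mem_nbhdBox hL hL7 mv kk k y κ hy) (fun μ p hp i => ?_) (fun μ p hp j => ?_) f (cvChi d L mv kk hL k) hf (fun q => abs_chiCube_le_one _ _)
    (fun p hp => cvChi_blockOf_mem hL mv kk k p hp)
  · exact (rows_cols_cvT_sub_one_le_of_datum ι e (scShift d L mv kk hL) hVu hη hg1 hA hD (nbhdBox_subset_localityBox hL hL17 mv kk hW2 k hp) μ).1 i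
  · exact (rows_cols_cvT_sub_one_le_of_datum ι e (scShift d L mv kk hL) hVu hη hg1 hA hD (nbhdBox_subset_localityBox hL hL17 mv kk hW2 k hp) μ).2 j

end Knit

end Summit.QuantumFields.YangMills.BalabanUVNodes.N15.Gluing

end
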